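import Summits.CriticalPhenomena.PercolationContinuityZ3.Theorems.PercNearOneGluingNoHeavyQuantSGCNoLowRightPartial
import Summits.CriticalPhenomena.PercolationContinuityZ3.Theorems.PercNearOneGluingNoHeavyQuantSGCLightPairLayer
import HarnessLib

/-!
# QUANT lane R8, T-DEC, leg (III): gated products with a NO-LOW second factor — a flow at EVERY layer

builds on p205010 (kernel theorem, internal audit signed; external expert review pending)

Support file (`--supports stmt-CriticalPhenomena-4575`), QUANT lane seat prim-quant-arm-2 (gen 37), rung R8 of
`run/shared/lean/prim/quant/LADDER.md`.  One theorem, standard axioms, no sorries.  The many-copy analogue of `flowAtT_lightPair_layer`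
(`…QuantSGCLightPairLayer`): for `L 0 = 1 − q`, `L t = Σ_{s ≤ M₂} w_s·[s ≤ t]·qμ₁(t−s)` (`t ≥ 1`) with NO-LOW weights (`w_s > 0 ⟹ Δ ≤ 2s`),
mass `1`, mean the target `S + Δ`, `y·M ≤ S + Δ`, `y ≤ q`, and flows of `gate_q μ₁` at every layer, `L` has a flow at every layer `j < M`:
`noLow_partial` (pooled partial flow of the present copies) + `flowAtT_of_partial_dichotomy`, the certified giant rooms of the present copies
and the whole of the absent ones being located inside `Σ_{j<h≤M} L h` (`copy_giants_le`, `copy_all_giants_le`).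

* **`LawDec.flowAtT_noLow_layer`**.

[this work].  The gluing rows served [cite: KozmaNitzan2024, Conjecture 3 (p. 15)]; product measure [cite: Grimmett1999, §1.3 p. 10].
-/

noncomputable section

namespace Summit.CriticalPhenomena.PercolationContinuityZ3.Theorems

namespace Quant

open Finset

namespace LawDec

/-- **A FLOW AT EVERY LAYER for a gated product with a no-low second factor** (file header). [this work] -/
theorem flowAtT_noLow_layer (y S Δ q : ℝ) (j M₁ M₂ M : ℕ) (μ₁ L w : ℕ → ℝ)
    (hy0 : 0 < y) (hy1 : y < 1) (hq0 : 0 < q) (hyq : y ≤ q) (hS : 0 < S) (hΔ0 : 0 < Δ)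
    (hw0 : ∀ s, 0 ≤ w s) (hw1 : ∑ s ∈ Finset.range (M₂ + 1), w s = 1) (hnolow : ∀ s, 0 < w s → Δ ≤ 2 * (s : ℝ))
    (hM : M₁ + M₂ ≤ M) (hjM : j < M) (hμ0 : ∀ h, 0 ≤ μ₁ h) (hμ1 : ∑ h ∈ Finset.range (M₁ + 1), μ₁ h = 1)
    (hF : ∀ J, FlowAtT y S J M₁ (gate μ₁ q))
    (hLnn : ∀ t, 0 ≤ L t) (hL0 : L 0 = 1 - q)
    (hL : ∀ t, 1 ≤ t → L t = ∑ s ∈ Finset.range (M₂ + 1), w s * (if s ≤ t then q * μ₁ (t - s) else 0))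
    (hL1 : ∑ t ∈ Finset.range (M + 1), L t = 1) (hLmean : ∑ t ∈ Finset.range (M + 1), (t : ℝ) * L t = S + Δ)
    (hta : y * (M : ℝ) ≤ S + Δ) :
    FlowAtT y (S + Δ) j M L := by
  classical
  have h1y : 0 < 1 - y := by linarith
  have hS' : 0 < S + Δ := by linarith
  have huy0 : 0 < y / (1 - y) := div_pos hy0 h1y
  have hzero : y / (1 - y) * (1 - q) ≤ q := by
    rw [div_mul_eq_mul_div, div_le_iff₀ h1y]; nlinarith
  have hw00 : w 0 = 0 := by
    rcases (hw0 0).eq_or_lt with hz | hp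
    · exact hz.symm
    · have := hnolow 0 hp; simp at this; linarith
  set C : Finset ℕ := (Finset.range (M₂ + 1)).filter (fun s => 1 ≤ s ∧ s ≤ j ∧ 0 < w s) with hC
  -- source flows of every copy
  set f : ℕ → ℕ → ℕ → ℝ := fun s => Classical.choose (hF (j - s)) with hf
  have hfs : ∀ s, 1 ≤ s → s ≤ j → s ≤ M₂ → 0 < w s → IsFlowAtT y S (j - s) M₁ (gate μ₁ q) (f s) :=
    fun s _ _ _ _ => Classical.choose_spec (hF (j - s))
  obtain ⟨φ, hφ0, hφsupp, hφz, hcolφ, hrows, hdich⟩ :=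
    noLow_partial y S Δ q j M₁ M₂ M μ₁ L w f hy0 hy1 hq0 hS hΔ0 hw0 hnolow hjM hM hμ0 hfs hL
  -- the product's giants along the copies
  have hLgiants : ∑ h ∈ Finset.Ico (j + 1) (M + 1), L h
      = ∑ s ∈ Finset.range (M₂ + 1), w s * ∑ h ∈ Finset.Ico (j + 1) (M + 1), (if s ≤ h then q * μ₁ (h - s) else 0) := by
    calc ∑ h ∈ Finset.Ico (j + 1) (M + 1), L h
        = ∑ h ∈ Finset.Ico (j + 1) (M + 1), ∑ s ∈ Finset.range (M₂ + 1), w s * (if s ≤ h then q * μ₁ (h - s) else 0) :=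
          Finset.sum_congr rfl fun h hh => hL h (by have := (Finset.mem_Ico.1 hh).1; omega)
      _ = ∑ s ∈ Finset.range (M₂ + 1), ∑ h ∈ Finset.Ico (j + 1) (M + 1), w s * (if s ≤ h then q * μ₁ (h - s) else 0) :=
          Finset.sum_comm
      _ = _ := Finset.sum_congr rfl fun s _ => by rw [Finset.mul_sum]
  -- each copy's giant term dominates what the dichotomy needs from it
  have hper : ∀ s ∈ Finset.range (M₂ + 1),
      (if (1 ≤ s ∧ s ≤ j ∧ 0 < w s) then w s * ∑ h ∈ Finset.Ico (j - s + 1) (M₁ + 1), gate μ₁ q h else 0)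
        + (if (1 ≤ s ∧ s ≤ j ∧ 0 < w s) then 0 else y / (1 - y) * (1 - q) * w s)
        ≤ w s * ∑ h ∈ Finset.Ico (j + 1) (M + 1), (if s ≤ h then q * μ₁ (h - s) else 0) := by
    intro s hsr
    rw [Finset.mem_range] at hsr
    by_cases hc : (1 ≤ s ∧ s ≤ j ∧ 0 < w s)
    · rw [if_pos hc, if_pos hc, add_zero]
      exact mul_le_mul_of_nonneg_left (copy_giants_le q j s M₁ M μ₁ hq0.le hμ0 hc.2.1 (by omega)) (hw0 s)
    · rw [if_neg hc, if_neg hc, zero_add]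
      rcases (hw0 s).eq_or_lt with hz | hp
      · rw [← hz]; simp
      · have hs0 : s ≠ 0 := fun h => by rw [h, hw00] at hp; exact lt_irrefl _ hp
        have hjs : j < s := by
          by_contra hle; exact hc ⟨by omega, by omega, hp⟩
        have h2 := copy_all_giants_le q j s M₁ M μ₁ hq0.le hμ0 hjs (by omega)
        rw [hμ1, mul_one] at h2
        calc y / (1 - y) * (1 - q) * w s ≤ q * w s := mul_le_mul_of_nonneg_right hzero hp.le
          _ = w s * q := mul_comm _ _
          _ ≤ _ := mul_le_mul_of_nonneg_left h2 hp.le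
  have hsumC : ∑ s ∈ C, w s * ∑ h ∈ Finset.Ico (j - s + 1) (M₁ + 1), gate μ₁ q h
      = ∑ s ∈ Finset.range (M₂ + 1),
          (if (1 ≤ s ∧ s ≤ j ∧ 0 < w s) then w s * ∑ h ∈ Finset.Ico (j - s + 1) (M₁ + 1), gate μ₁ q h else 0) := by
    rw [hC, Finset.sum_filter]
  have hWC : ∑ s ∈ C, w s = ∑ s ∈ Finset.range (M₂ + 1), (if (1 ≤ s ∧ s ≤ j ∧ 0 < w s) then w s else 0) := by
    rw [hC, Finset.sum_filter]
  have hrest : 1 - ∑ s ∈ C, w s = ∑ s ∈ Finset.range (M₂ + 1), (if (1 ≤ s ∧ s ≤ j ∧ 0 < w s) then 0 else w s) := by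
    rw [hWC, ← hw1]
    rw [← Finset.sum_sub_distrib]
    exact Finset.sum_congr rfl fun s _ => by split_ifs <;> ring
  refine flowAtT_of_partial_dichotomy y (S + Δ)
    (∑ s ∈ C, w s * ∑ h ∈ Finset.Ico (j - s + 1) (M₁ + 1), gate μ₁ q h + y / (1 - y) * (1 - q) * (1 - ∑ s ∈ C, w s))
    j M L φ hy0 hy1 hS' hLnn hL1 hLmean hta hjM hφ0 hφsupp hφz hcolφ hrows ?_
  rcases hdich with hfull | hplaced
  · left
    refine ⟨?_, ?_⟩
    · rw [hL0]
      have e : y / (1 - y) * ((1 - q) + ∑ t ∈ Finset.range (j + 1),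
            (if (1 ≤ t ∧ t ≤ j ∧ 2 * (t : ℝ) < S + Δ) then L t - ∑ k ∈ Finset.range (M + 1), φ t k else 0))
          = y / (1 - y) * ((1 - q) * ∑ s ∈ C, w s + ∑ t ∈ Finset.range (j + 1),
            (if (1 ≤ t ∧ t ≤ j ∧ 2 * (t : ℝ) < S + Δ) then L t - ∑ k ∈ Finset.range (M + 1), φ t k else 0))
            + y / (1 - y) * (1 - q) * (1 - ∑ s ∈ C, w s) := by ring
      rw [e]
      linarith [hfull]
    · rw [hLgiants, hsumC, hrest, Finset.mul_sum, ← Finset.sum_add_distrib]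
      refine Finset.sum_le_sum fun s hs => ?_
      have h := hper s hs
      have e : y / (1 - y) * (1 - q) * (if (1 ≤ s ∧ s ≤ j ∧ 0 < w s) then (0 : ℝ) else w s)
          = (if (1 ≤ s ∧ s ≤ j ∧ 0 < w s) then (0 : ℝ) else y / (1 - y) * (1 - q) * w s) := by
        split_ifs <;> ring
      rw [e]; exact h
  · exact Or.inr hplaced

end LawDec

end Quant

end Summit.CriticalPhenomena.PercolationContinuityZ3.Theorems
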